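import Mathlib
import Summits.Ventures.FusionMHD.Models.RwmFRS1
import Literature.MathematicalPhysics.MHD.ShafranovShift
import HarnessLib

/-!
# F2 row «F2.SHAFRANOV-SHIFT-FRS1»: MODEL M_RWM (`RwmFRS1.P`) bent into the DECLARED `R₀ = 5a` torus — internal inductance `l_i = 4 ln 2 − 2`, `β_p = 0`, the bracket of (6.66) in closed form, OUTWARD shift of every interior flux surface, edge slope `Δ′(a) = −(2 ln 2 − 1)/5`, and Shafranov's vertical field `B_V = (I/20π)(2 ln 2 + ln 40 − 5/2)` (Freidberg's first-order `ε`-expansion; lit-4's `ShafranovShift`)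

LADDER-GRIDFUSION rung F2 (cell `gridfusion`; the cell's FIRST TOROIDAL-CORRECTION row, lead g11 RULING 9ep (2) candidate «#190
F2.SHAFRANOV-SHIFT-FRS1»): statements + proofs by gridfusion-lit-4 g11 (TEMPLATE #4 `HOME/lean/lit-4/templates/ShafranovShiftRwmFRS1.lean`
89813b0ecb8216f6, OFFER E, INBOX 2026-08-28T02:29:43Z) over its kernel file `Literature/MathematicalPhysics/MHD/ShafranovShift.lean`
(p597354; Freidberg §6.4.4–6.4.6 eqs. (6.58), (6.65)–(6.67), (6.72), (6.77), (6.83), (6.86)–(6.90) read on the page); FILED UNCHANGED but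
for hygiene (imports `Mathlib`/`HarnessLib`, this module docstring) by gridfusion-model-7 g8, 2026-08-28.  Every declaration, statement
and proof below is lit-4's, byte-identical.  0 kit, 0 named facts, no `native_decide`; `ln 2` enters only through Mathlib's certified
bounds `Real.log_two_gt_d9` / `Real.log_two_lt_d9`.

THREE COLUMNS.  CERTIFIED: for MODEL M_RWM (`RwmFRS1.P`: `B_θ = r/(7(1+r²))`, `B_z ≡ 1`, `p ≡ 0`, `μ₀ = 1`, `a = 1`) bent into the
DECLARED `R₀ = 5a` torus and treated by Freidberg's first-order `ε`-expansion of the Grad–Shafranov equation ((6.58), (6.65)–(6.67),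
(6.72), (6.77)): `l_i = 4 ln 2 − 2 ∈ (0.77258, 0.77259)` (6.86), `β_p = 0`, the source bracket (6.66) in closed form
`(ln(1+x²) + 1/(1+x²) − 1)/98`, every interior flux surface shifted OUTWARD (`Δ(r) > 0` on `0 < r < a`), the edge slope
`Δ′(a) = −(a/R₀)(β_p + l_i/2) = −(2 ln 2 − 1)/5`, and Shafranov's vertical field (6.90)
`B_V = (μ₀I/4πR₀)(β_p + (l_i − 3)/2 + ln 8R₀/a) = (I/20π)(2 ln 2 + ln 40 − 5/2)`.  VALIDATED: nothing numerical in the kernel beyond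
Mathlib's `ln 2`; the comparison object would be a free-boundary Grad–Shafranov code's shift / vertical field (none in the cell);
Freidberg's Alcator C check (Fig. 6.10) is qualitative.  MODELLED: MODEL M_RWM bent into the DECLARED `R₀ = 5a` torus, first-order
large-aspect-ratio expansion (`ε = 1/5`), circular boundary, `β_p ∼ 1` ordering evaluated at `β_p = 0`, last surface centred
(`r₂ = a`); nothing about a device.  Citations: Freidberg 2014 §6.4 [Freidberg2014]; objects = lit-4's `ShafranovShift` +
model-6/lit-4's `RwmFRS1.P`.  Everything below is [instance data].

lit-4's template header, verbatim:

> TEMPLATE #4 (gridfusion lit-4 g11, 2026-08-28): «F2.SHAFRANOV-SHIFT-FRS1» — the cell's first TOROIDAL-CORRECTION instance.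
> MODEL M_RWM's plasma column (RwmFRS1.P: B_θ = r/(7(1+r²)), B_z ≡ 1, p ≡ 0, μ₀ = 1, a = 1) bent into a torus of the
> DECLARED aspect ratio R₀ = 5a (as in RwmFRS1) and treated by Freidberg's first-order ε-expansion (§6.4.2–6.4.6; kernel
> file Literature/MathematicalPhysics/MHD/ShafranovShift.lean, p597354): CERTIFIED the internal inductance l_i = 4 ln 2 − 2
> ∈ (0.77258, 0.77259), β_p = 0, the square bracket in closed form, the edge slope of the Shafranov shift
> Δ′(a) = −(a/R₀)(β_p + l_i/2) = −(2 ln 2 − 1)/5, the outward shift of every interior surface, and Shafranov's vertical field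
> B_V(I) = (I/20π)(2 ln 2 + ln 40 − 5/2) per unit current (6.90).  VALIDATED: nothing numerical (a free-boundary Grad–Shafranov
> code's shift would be the comparison); MODELLED: first-order large-aspect-ratio expansion, circular boundary, zero β.
> Compiles against the tree after p597354.  Model seats: move into your namespace; nothing here is booked or filed by lit-4.
-/

noncomputable section

open Set Real MeasureTheory intervalIntegral Literature.MathematicalPhysics.MHD Literature.MathematicalPhysics.MHD.ScrewPinch

namespace Summit.Ventures.FusionMHD.Models

namespace RwmFRS1

namespace Torus

/-- The pressure of M_RWM is identically zero, so `p′ ≡ 0`. [instance data] -/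
theorem deriv_p (r : ℝ) : deriv P.p r = 0 := by
  have h : P.p = fun _ => (0 : ℝ) := funext P_p
  rw [h, deriv_const]

/-- The bracket integrand of (6.66) for M_RWM: `y B_θ² − 2μ₀y²p′ = y³/(49(1+y²)²)`. [instance data] -/
theorem integrand_eq (y : ℝ) :
    y * P.Bθ y ^ 2 - 2 * P.μ₀ * y ^ 2 * deriv P.p y = y ^ 3 / (49 * (1 + y ^ 2) ^ 2) := by
  rw [P_Bθ, deriv_p, P_μ₀]
  have h : (0 : ℝ) < 1 + y ^ 2 := by positivity
  field_simp
  ring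

/-- The elementary integral `∫_0^x y³/(49(1+y²)²) dy = (ln(1+x²) + 1/(1+x²) − 1)/98`. [instance data] -/
theorem integral_integrand {x : ℝ} (hx : 0 ≤ x) :
    ∫ y in (0:ℝ)..x, y ^ 3 / (49 * (1 + y ^ 2) ^ 2) = (Real.log (1 + x ^ 2) + 1 / (1 + x ^ 2) - 1) / 98 := by
  have hΦd : ∀ y ∈ Ioo (0:ℝ) x, HasDerivAt (fun y : ℝ => (Real.log (1 + y ^ 2) + 1 / (1 + y ^ 2)) / 98)
      (y ^ 3 / (49 * (1 + y ^ 2) ^ 2)) y := by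
    intro y _
    have h1 : (0 : ℝ) < 1 + y ^ 2 := by positivity
    have hin : HasDerivAt (fun y : ℝ => 1 + y ^ 2) (2 * y) y := by
      simpa using (hasDerivAt_pow 2 y).const_add 1
    have hlog := hin.log h1.ne'
    have hinv := (hasDerivAt_const y (1:ℝ)).div hin h1.ne'
    have h := (hlog.add hinv).div_const 98
    refine h.congr_deriv ?_
    field_simp
    ring
  have hΦc : ContinuousOn (fun y : ℝ => (Real.log (1 + y ^ 2) + 1 / (1 + y ^ 2)) / 98) (Icc 0 x) := by
    have h1 : ∀ y : ℝ, (1 + y ^ 2) ≠ 0 := fun y => by positivity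
    refine ContinuousOn.div_const (ContinuousOn.add ?_ ?_) 98
    · exact ContinuousOn.log (by fun_prop) fun y _ => h1 y
    · exact continuousOn_const.div (by fun_prop) fun y _ => h1 y
  have hint : IntervalIntegrable (fun y : ℝ => y ^ 3 / (49 * (1 + y ^ 2) ^ 2)) volume 0 x := by
    refine (Continuous.continuousOn ?_).intervalIntegrable
    exact Continuous.div (by fun_prop) (by fun_prop) fun y => by positivity
  rw [intervalIntegral.integral_eq_sub_of_hasDerivAt_of_le hx hΦc hΦd hint]
  simp
  ring

/-- THE SQUARE BRACKET of (6.66) for M_RWM in closed form (`x ≥ 0`):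
`∫_0^x [yB_θ² − 2μ₀y²p′] dy = (ln(1+x²) + 1/(1+x²) − 1)/98`. [instance data] -/
theorem torBracket_eq {x : ℝ} (hx : 0 ≤ x) :
    P.torBracket x = (Real.log (1 + x ^ 2) + 1 / (1 + x ^ 2) - 1) / 98 := by
  unfold ScrewPinch.Profile.torBracket
  rw [intervalIntegral.integral_congr (fun y _ => integrand_eq y)]
  exact integral_integrand hx

/-- `β_p = 0` (zero pressure). [instance data] -/
theorem rfpBetaP_eq : P.rfpBetaP 1 = 0 := by
  unfold ScrewPinch.Profile.rfpBetaP ScrewPinch.Profile.areaAvg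
  simp

/-- **`l_i = 4 ln 2 − 2`** for the peaked profile `B_θ = r/(7(1+r²))` (Freidberg (6.86)). [instance data] -/
theorem internalInductance_eq : P.internalInductance 1 = 4 * Real.log 2 - 2 := by
  unfold ScrewPinch.Profile.internalInductance ScrewPinch.Profile.areaAvg
  have e : ∫ r in (0:ℝ)..1, P.Bθ r ^ 2 * r = ∫ y in (0:ℝ)..1, y ^ 3 / (49 * (1 + y ^ 2) ^ 2) :=
    intervalIntegral.integral_congr fun r _ => by
      rw [P_Bθ]
      have h : (0 : ℝ) < 1 + r ^ 2 := by positivity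
      field_simp
      ring
  rw [e, integral_integrand zero_le_one, P_Bθ]
  norm_num
  ring

/-- **`0.77258 < l_i < 0.77259`** (Mathlib's certified `ln 2`). [instance data] -/
theorem internalInductance_bounds : 0.77258 < P.internalInductance 1 ∧ P.internalInductance 1 < 0.77259 := by
  rw [internalInductance_eq]
  have h1 := Real.log_two_gt_d9
  have h2 := Real.log_two_lt_d9
  constructor <;> linarith

/-- THE EDGE VALUE OF THE BRACKET `= a²B_θa²(β_p + l_i/2) = (ln 2 − 1/2)/98` (check of (6.87) at `x = a`). [instance data] -/
theorem torBracket_one : P.torBracket 1 = (Real.log 2 - 1 / 2) / 98 := by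
  rw [torBracket_eq zero_le_one]
  norm_num
  ring

/-- The hypotheses of the kernel file for M_RWM: `B_θ` continuous on `[0, ∞)`. [instance data] -/
theorem continuousOn_Bθ : ContinuousOn P.Bθ (Ici 0) := by
  have h : P.Bθ = fun r => r / (7 * (1 + r ^ 2)) := funext P_Bθ
  rw [h]
  exact (Continuous.div (by fun_prop) (by fun_prop) fun r => by positivity).continuousOn

/-- `B_θ ≠ 0` for `r > 0`. [instance data] -/
theorem Bθ_ne_zero (r : ℝ) (hr : 0 < r) : P.Bθ r ≠ 0 := by
  rw [P_Bθ]
  have h : (0 : ℝ) < 1 + r ^ 2 := by positivity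
  positivity

/-- The bracket integrand is continuous on `[0, ∞)`. [instance data] -/
theorem continuousOn_integrand :
    ContinuousOn (fun y => y * P.Bθ y ^ 2 - 2 * P.μ₀ * y ^ 2 * deriv P.p y) (Ici 0) := by
  have h : (fun y => y * P.Bθ y ^ 2 - 2 * P.μ₀ * y ^ 2 * deriv P.p y) = fun y => y ^ 3 / (49 * (1 + y ^ 2) ^ 2) :=
    funext integrand_eq
  rw [h]
  exact (Continuous.div (by fun_prop) (by fun_prop) fun y => by positivity).continuousOn

/-- **EVERY INTERIOR FLUX SURFACE IS SHIFTED OUTWARD** relative to the boundary: `Δ(r) > 0` for `0 < r < a = 1`,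
`R₀ = 5`. [instance data] -/
theorem fluxShift_pos {r : ℝ} (hr : 0 < r) (hr1 : r < 1) : 0 < P.fluxShift 5 1 r :=
  ScrewPinch.Profile.fluxShift_pos (P := P) (by norm_num) hr hr1 (by rw [P_μ₀]; norm_num) continuousOn_Bθ Bθ_ne_zero
    (fun y _ => by rw [deriv_p]) continuousOn_integrand

/-- **THE EDGE SLOPE OF THE SHAFRANOV SHIFT: `Δ′(a) = −(a/R₀)(β_p + l_i/2) = −(2 ln 2 − 1)/5`** (`a = 1`, `R₀ = 5`).
[instance data] -/
theorem hasDerivAt_fluxShift_edge : HasDerivAt (fun s => P.fluxShift 5 1 s) (-((2 * Real.log 2 - 1) / 5)) 1 := by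
  have hp0 : P.p = fun _ => (0 : ℝ) := funext P_p
  have hpc : ContinuousOn P.p (Icc 0 1) := by rw [hp0]; exact continuousOn_const
  have hpd : ∀ y ∈ Ioo (0:ℝ) 1, DifferentiableAt ℝ P.p y := fun y _ => by
    rw [hp0]; exact differentiableAt_const 0
  have hpi : IntervalIntegrable (fun y => y ^ 2 * deriv P.p y) volume 0 1 := by
    have e : (fun y => y ^ 2 * deriv P.p y) = fun _ => (0 : ℝ) := by
      funext y; rw [deriv_p, mul_zero]
    rw [e]; exact intervalIntegrable_const
  have h := ScrewPinch.Profile.hasDerivAt_fluxShift_edge (P := P) (R₀ := 5) (by norm_num) one_pos continuousOn_Bθ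
    Bθ_ne_zero continuousOn_integrand hpc hpd hpi (P_p 1)
  rw [rfpBetaP_eq, internalInductance_eq] at h
  refine h.congr_deriv ?_
  ring

/-- **SHAFRANOV'S VERTICAL FIELD PER UNIT CURRENT for the toroidal M_RWM** (`μ₀ = 1`, `R₀ = 5`, `a = 1`):
`B_V = (I/20π)(2 ln 2 + ln 40 − 5/2)` (Freidberg (6.90) with `β_p = 0`, `l_i = 4 ln 2 − 2`). [instance data] -/
theorem verticalField_eq (I : ℝ) :
    Profile.shafranovVerticalField 1 I 5 1 (P.rfpBetaP 1) (P.internalInductance 1)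
      = I / (20 * π) * (2 * Real.log 2 + Real.log 40 - 5 / 2) := by
  unfold ScrewPinch.Profile.shafranovVerticalField
  rw [rfpBetaP_eq, internalInductance_eq]
  have hπ : (π : ℝ) ≠ 0 := Real.pi_ne_zero
  field_simp
  norm_num
  ring

end Torus

end RwmFRS1

end Summit.Ventures.FusionMHD.Models

end
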